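import Mathlib
import Summits.ResolutionOfSingularities.ResolutionOfSingularities.Theorems.HomologicalConductorPersistenceArenaGeneral
import Summits.ResolutionOfSingularities.ResolutionOfSingularities.Theorems.HomologicalConductorPersistenceArArrivalFloor
import Summits.ResolutionOfSingularities.ResolutionOfSingularities.Theorems.HomologicalConductorPersistenceQuotientAscentCodimTwo
import Literature.RingTheory.CohomologyAnnihilator.Localization
import HarnessLib

/-!
# Rung S-2 `PersistenceSurface` (stmt-ResolutionOfSingularities-19970) — the cA-ARENA FLOOR in EVERY CHARACTERISTIC:
# `(x, y) + ι(caⁿ⁺¹(k[z]/(h)))·T_h ≤ caⁿ⁺³(T_h)`, `T_h = k[x,y,z₁,…,z_{n+1}]/(xy − h)`, with NO hypothesis `2 ≠ 0`;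
# the `A_r` floor `(x, y, z^⌊m/2⌋) ⊆ ca³(k[x,y,z]/(xy − zᵐ))` over every field

Route `ResolutionOfSingularities/HomologicalConductor`, chain W4.4b (cell res-hironaka; seat res-L1-w44b-stub-1
gen 6, lead-1 WAVE-3 row «arena cells (C2 kernel side)»). `[OURS · L1 w44b]` replaces the role of no printed item;
NOT a statement of the manuscript under review (Hironaka 2017), nothing here is attributed to its author; folklore
commutative algebra, AI-written (weaker than expert review).

## What and why

Stub-2's ARENA LOWER BOUND (`ArenaGeneral.mk_inclusion_mem_cohomologyAnnihilatorOfDegree`, p544909):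
`c̄ ∈ caⁿ⁺¹(k[z]/(h)) ⇒ (ι c)‾ ∈ caⁿ⁺³(k[x,y,z]/(xy − ι h))` for `2 ≠ 0`, `h ≠ 0` — the hypothesis `2 ≠ 0` being
borne by the METHOD (two one-step quotient ascents along `T_h ↠ B_h = k[x,z]/(x² − h) ↠ C_h`, the second through
the Jacobian element `∂ₓ(x² − h) = 2x`), and flagged by res-L1-w44b-tri-2 (TRIAGE v18 R68: «`h2 : 2 ≠ 0` is
method-borne — p = 2 `A_r` arrivals not covered»; the rung quantifies over EVERY characteristic).  This file removes
it: the CODIMENSION-TWO QUOTIENT ASCENT (`…PersistenceQuotientAscentCodimTwo`, this seat) ascends both steps at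
once, using only that `a = x̄ − ȳ` and `b = x̄` — a regular sequence on `T_h` with `T_h/(a, b) = C_h` — are BOTH
Jacobian elements of the TOP ring `T_h` (`x = ∂f/∂y`, `y = ∂f/∂x`, `f = xy − h`: no `2`).

* §1 `F'_ne_zero'`, `mk_X0_sub_X1_mem_nonZeroDivisors'` — `x² − ι′h ≠ 0` and `x̄ − ȳ ∈ T_h⁰` for every field
  (stub-2's versions differentiate and need `2 ≠ 0`; here: the retraction `x ↦ 0` sends `x² − ι′h` to `−h`).
* §2 **`mk_inclusion_mem_cohomologyAnnihilatorOfDegree'`** — `h ≠ 0`, `c̄ ∈ caⁿ⁺¹(C_h)` ⇒ `(ι c)‾ ∈ caⁿ⁺³(T_h)`, EVERY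
  field; ideal form `map_le_cohomologyAnnihilatorOfDegree'` (`((x, y) + ι((caⁿ⁺¹ C_h).comap mk))·T_h ≤ caⁿ⁺³(T_h)`),
  localised form, and the `ca`-form `map_le_cohomologyAnnihilator'`.
* §3 **`X_two_pow_half_mem_cohomologyAnnihilatorOfDegree_three'`** — the `A_{m−1}` surface `xy = zᵐ` over ANY
  field: `z̄^⌊m/2⌋ ∈ ca³` (with this seat's `z̄^⌊m/2⌋ ∈ ca¹(k[z]/(zᵐ))`, p558318), hence
  `span_le_cohomologyAnnihilatorOfDegree_three_arena'`: **`(x̄, ȳ, z̄^⌊m/2⌋) ⊆ ca³(k[x,y,z]/(xy − zᵐ))`** — the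
  `A_r`-arrival floor of the S-2 ledger now holds at `p = 2` as well.

The reverse inclusions (ceilings) of `…PersistenceArenaGlue` / `…ArenaIdealFormula` still carry `2 ≠ 0` (two
branched-cover descents); for the surface `xy = zᵐ` a characteristic-free ceiling follows from the Knörrer
certificate transfer (`…PersistenceKnorrerTransfer`, 1 × 1 factorisations `zⁱ · zᵐ⁻ⁱ`) — not in this file.

References (mechanism only): S. B. Iyengar, R. Takahashi, IMRN 2016, arXiv:1404.1476, §2 [`IyengarTakahashi2014`];
H. Knörrer, Invent. Math. 88 (1987); Ö. Esentepe, J. Algebra 541 (2020) Thm 5.4 [`Esentepe2020`].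
-/

noncomputable section

-- single-problem summit: the doubled namespace component `ResolutionOfSingularities` is forced
set_option linter.dupNamespace false

namespace Summit.ResolutionOfSingularities.ResolutionOfSingularities.Theorems.HomologicalConductor.ArenaFloorCharFree

open MvPolynomial Literature.RingTheory.CohomologyAnnihilator
open Summit.ResolutionOfSingularities.ResolutionOfSingularities.Theorems.HomologicalConductor
open Summit.ResolutionOfSingularities.ResolutionOfSingularities.Theorems.HomologicalConductor.KC3Lower
open Summit.ResolutionOfSingularities.ResolutionOfSingularities.Theorems.HomologicalConductor.QuotientAscentCodimTwo
open scoped nonZeroDivisors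

universe u

variable (k : Type u) [Field k] (n : ℕ)

/-! ## §1 `x² − ι′h ≠ 0` and `x̄ − ȳ ∈ T_h⁰` over every field -/

/-- `x² − ι′h ≠ 0` over EVERY field (the retraction `x ↦ 0` sends it to `−h`; if `h = 0` it is `x² ≠ 0`). [folklore] -/
theorem F'_ne_zero' (h : MvPolynomial (Fin (n + 1)) k) :
    (X 0 ^ 2 - (MvPolynomial.aeval (fun j : Fin (n + 1) => (X j.succ : MvPolynomial (Fin (n + 2)) k))) h) ≠ 0 := by
  intro h0
  have h1 := congrArg (MvPolynomial.aeval (Fin.cons 0 X : Fin (n + 2) → MvPolynomial (Fin (n + 1)) k)) h0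
  rw [ArenaGeneralMiddle.retraction_F', map_zero, neg_eq_zero] at h1
  rw [h1, map_zero, sub_zero] at h0
  exact pow_ne_zero 2 (MvPolynomial.X_ne_zero (0 : Fin (n + 2))) h0

/-- `x̄ − ȳ ∈ T_h⁰` over EVERY field (stub-2's `ArenaGeneral.mk_X0_sub_X1_mem_nonZeroDivisors` minus `2 ≠ 0`):
`σ : y ↦ x` has kernel `(x − y)` and sends `xy − ι h` to the non-zero `x² − ι′ h`. [folklore] -/
theorem mk_X0_sub_X1_mem_nonZeroDivisors' (h : MvPolynomial (Fin (n + 1)) k) :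
    Ideal.Quotient.mk (Ideal.span ({X 0 * X 1 - (MvPolynomial.aeval (fun j : Fin (n + 1) =>
        (X j.succ.succ : MvPolynomial (Fin (n + 3)) k))) h} : Set (MvPolynomial (Fin (n + 3)) k))) (X 0 - X 1) ∈
      (MvPolynomial (Fin (n + 3)) k ⧸ Ideal.span ({X 0 * X 1 - (MvPolynomial.aeval (fun j : Fin (n + 1) =>
        (X j.succ.succ : MvPolynomial (Fin (n + 3)) k))) h} : Set (MvPolynomial (Fin (n + 3)) k)))⁰ := by
  refine mk_mem_nonZeroDivisors_of_ringHom
    (MvPolynomial.aeval (Fin.cons (X 0) (Fin.cons (X 0) fun j : Fin (n + 1) => X j.succ) :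
      Fin (n + 3) → MvPolynomial (Fin (n + 2)) k)).toRingHom
    (mem_nonZeroDivisors_of_ne_zero ?_) ?_ (fun q hq => ?_) ?_
  · intro h0
    have h1 := congrArg (MvPolynomial.pderiv 0) h0
    simp [MvPolynomial.pderiv_X] at h1
  · rw [AlgHom.toRingHom_eq_coe, RingHom.coe_coe, map_sub, MvPolynomial.aeval_X, MvPolynomial.aeval_X, Fin.cons_zero,
      show (1 : Fin (n + 3)) = Fin.succ 0 from rfl, Fin.cons_succ, Fin.cons_zero, sub_self]
  · have hq' := ArenaGeneral.sub_inclusion_sigma_mem k n q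
    rw [AlgHom.toRingHom_eq_coe, RingHom.coe_coe] at hq
    rw [hq, map_zero, sub_zero] at hq'
    exact Ideal.mem_span_singleton.mp hq'
  · rw [AlgHom.toRingHom_eq_coe, RingHom.coe_coe, ArenaGeneral.sigma_f]
    exact mem_nonZeroDivisors_of_ne_zero (F'_ne_zero' k n h)

/-! ## §2 The arena floor in every characteristic -/

/-- **ARENA LOWER BOUND, EVERY FIELD (OURS · L1 w44b).** `0 ≠ h ∈ k[z₁,…,z_{n+1}]`, `c̄ ∈ caⁿ⁺¹(k[z]/(h))` ⇒
`(ι c)‾ ∈ caⁿ⁺³(k[x,y,z]/(xy − ι h))` — with NO hypothesis on the characteristic.  Proof: the codimension-two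
quotient ascent (`QuotientAscentCodimTwo.mem_cohomologyAnnihilatorOfDegree_of_surjective_surjective`) along
`T_h ↠ B_h ↠ C_h` with `a = x̄ − ȳ ∈ T_h⁰`, `b = x̄` (`x̄ ∈ B_h⁰`), both in `caⁿ⁺³(T_h)` as Jacobian elements
(`ArenaGeneral.mk_X0/X1_mem_cohomologyAnnihilatorOfDegree`, `d = n + 2`). [cite: IyengarTakahashi2014, Remark 2.12] -/
theorem mk_inclusion_mem_cohomologyAnnihilatorOfDegree' (h : MvPolynomial (Fin (n + 1)) k) (hh : h ≠ 0)
    (c : MvPolynomial (Fin (n + 1)) k)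
    (hc : Ideal.Quotient.mk (Ideal.span ({h} : Set (MvPolynomial (Fin (n + 1)) k))) c ∈
      cohomologyAnnihilatorOfDegree (MvPolynomial (Fin (n + 1)) k ⧸ Ideal.span ({h} : Set (MvPolynomial (Fin (n + 1)) k)))
        (n + 1)) :
    Ideal.Quotient.mk (Ideal.span ({X 0 * X 1 - (MvPolynomial.aeval (fun j : Fin (n + 1) =>
        (X j.succ.succ : MvPolynomial (Fin (n + 3)) k))) h} : Set (MvPolynomial (Fin (n + 3)) k)))
        ((MvPolynomial.aeval (fun j : Fin (n + 1) => (X j.succ.succ : MvPolynomial (Fin (n + 3)) k))) c) ∈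
      cohomologyAnnihilatorOfDegree (MvPolynomial (Fin (n + 3)) k ⧸ Ideal.span ({X 0 * X 1 -
        (MvPolynomial.aeval (fun j : Fin (n + 1) => (X j.succ.succ : MvPolynomial (Fin (n + 3)) k))) h} :
          Set (MvPolynomial (Fin (n + 3)) k))) (n + 3) := by
  obtain ⟨Ψ, hΨsurj, hkerΨ, hΨ⟩ := ArenaGeneral.exists_ringHom_middleStage k n h
  obtain ⟨π, hπsurj, hkerπ, hπ⟩ := ArenaGeneralMiddle.exists_ringHom_curveStage k n h
  -- `Ψ x̄ = x̄`
  have hΨb : Ψ (Ideal.Quotient.mk _ (X 0)) = Ideal.Quotient.mk _ (X 0) := by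
    rw [hΨ, MvPolynomial.aeval_X, Fin.cons_zero]
  have hkerπ' : RingHom.ker π = Ideal.span {Ψ (Ideal.Quotient.mk _ (X 0))} := by rw [hΨb]; exact hkerπ
  have hb : Ψ (Ideal.Quotient.mk _ (X 0)) ∈ (MvPolynomial (Fin (n + 2)) k ⧸ Ideal.span ({X 0 ^ 2 -
      (MvPolynomial.aeval (fun j : Fin (n + 1) => (X j.succ : MvPolynomial (Fin (n + 2)) k))) h} :
        Set (MvPolynomial (Fin (n + 2)) k)))⁰ := by
    rw [hΨb]
    exact ArenaGeneralMiddle.mk_X0_mem_nonZeroDivisors k n h hh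
  have ha := Ideal.sub_mem _ (ArenaGeneral.mk_X0_mem_cohomologyAnnihilatorOfDegree k n h)
    (ArenaGeneral.mk_X1_mem_cohomologyAnnihilatorOfDegree k n h)
  rw [← map_sub] at ha
  refine mem_cohomologyAnnihilatorOfDegree_of_surjective_surjective Ψ hΨsurj hkerΨ
    (mk_X0_sub_X1_mem_nonZeroDivisors' k n h) π hπsurj hkerπ' hb (m := n) ha
    (ArenaGeneral.mk_X0_mem_cohomologyAnnihilatorOfDegree k n h) ?_
  rw [hΨ, ArenaGeneral.sigma_inclusion, hπ, ArenaGeneralMiddle.retraction_comp_inclusion]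
  exact hc

/-- **Ideal form, every field**: `((x, y) + ι((caⁿ⁺¹ C_h).comap mk))·T_h ≤ caⁿ⁺³(T_h)`. [OURS · L1 w44b] -/
theorem map_le_cohomologyAnnihilatorOfDegree' (h : MvPolynomial (Fin (n + 1)) k) (hh : h ≠ 0) :
    (Ideal.span ({X 0, X 1} : Set (MvPolynomial (Fin (n + 3)) k)) ⊔
        ((cohomologyAnnihilatorOfDegree (MvPolynomial (Fin (n + 1)) k ⧸
            Ideal.span ({h} : Set (MvPolynomial (Fin (n + 1)) k))) (n + 1)).comap
          (Ideal.Quotient.mk (Ideal.span ({h} : Set (MvPolynomial (Fin (n + 1)) k))))).map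
          (MvPolynomial.aeval (fun j : Fin (n + 1) => (X j.succ.succ : MvPolynomial (Fin (n + 3)) k))).toRingHom).map
        (Ideal.Quotient.mk (Ideal.span ({X 0 * X 1 - (MvPolynomial.aeval (fun j : Fin (n + 1) =>
          (X j.succ.succ : MvPolynomial (Fin (n + 3)) k))) h} : Set (MvPolynomial (Fin (n + 3)) k)))) ≤
      cohomologyAnnihilatorOfDegree (MvPolynomial (Fin (n + 3)) k ⧸ Ideal.span ({X 0 * X 1 -
        (MvPolynomial.aeval (fun j : Fin (n + 1) => (X j.succ.succ : MvPolynomial (Fin (n + 3)) k))) h} :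
          Set (MvPolynomial (Fin (n + 3)) k))) (n + 3) := by
  rw [Ideal.map_sup, sup_le_iff]
  constructor
  · rw [Ideal.map_span, Ideal.span_le]
    rintro _ ⟨g, hg, rfl⟩
    simp only [Set.mem_insert_iff, Set.mem_singleton_iff] at hg
    rcases hg with rfl | rfl
    · exact ArenaGeneral.mk_X0_mem_cohomologyAnnihilatorOfDegree k n h
    · exact ArenaGeneral.mk_X1_mem_cohomologyAnnihilatorOfDegree k n h
  · rw [Ideal.map_map, Ideal.map_le_iff_le_comap]
    intro c hc
    rw [Ideal.mem_comap] at hc ⊢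
    exact mk_inclusion_mem_cohomologyAnnihilatorOfDegree' k n h hh c hc

/-- **Localised form, every field**, at any `IsLocalization M T` of `T_h` (e.g. the local ring of a tower stage).
[OURS · L1 w44b] -/
theorem map_map_le_cohomologyAnnihilatorOfDegree_of_isLocalization' (h : MvPolynomial (Fin (n + 1)) k) (hh : h ≠ 0)
    (M : Submonoid (MvPolynomial (Fin (n + 3)) k ⧸ Ideal.span ({X 0 * X 1 - (MvPolynomial.aeval (fun j : Fin (n + 1) =>
      (X j.succ.succ : MvPolynomial (Fin (n + 3)) k))) h} : Set (MvPolynomial (Fin (n + 3)) k))))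
    (T : Type u) [CommRing T]
    [Algebra (MvPolynomial (Fin (n + 3)) k ⧸ Ideal.span ({X 0 * X 1 - (MvPolynomial.aeval (fun j : Fin (n + 1) =>
      (X j.succ.succ : MvPolynomial (Fin (n + 3)) k))) h} : Set (MvPolynomial (Fin (n + 3)) k))) T] [IsLocalization M T] :
    ((Ideal.span ({X 0, X 1} : Set (MvPolynomial (Fin (n + 3)) k)) ⊔
        ((cohomologyAnnihilatorOfDegree (MvPolynomial (Fin (n + 1)) k ⧸
            Ideal.span ({h} : Set (MvPolynomial (Fin (n + 1)) k))) (n + 1)).comap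
          (Ideal.Quotient.mk (Ideal.span ({h} : Set (MvPolynomial (Fin (n + 1)) k))))).map
          (MvPolynomial.aeval (fun j : Fin (n + 1) => (X j.succ.succ : MvPolynomial (Fin (n + 3)) k))).toRingHom).map
        (Ideal.Quotient.mk (Ideal.span ({X 0 * X 1 - (MvPolynomial.aeval (fun j : Fin (n + 1) =>
          (X j.succ.succ : MvPolynomial (Fin (n + 3)) k))) h} : Set (MvPolynomial (Fin (n + 3)) k))))).map
        (algebraMap (MvPolynomial (Fin (n + 3)) k ⧸ Ideal.span ({X 0 * X 1 - (MvPolynomial.aeval (fun j : Fin (n + 1) =>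
          (X j.succ.succ : MvPolynomial (Fin (n + 3)) k))) h} : Set (MvPolynomial (Fin (n + 3)) k))) T) ≤
      cohomologyAnnihilatorOfDegree T (n + 3) :=
  (Ideal.map_mono (map_le_cohomologyAnnihilatorOfDegree' k n h hh)).trans
    (map_cohomologyAnnihilatorOfDegree_le_of_isLocalization M T (n + 3))

/-- **`ca`-form, every field**: `c̄ ∈ ca(C_h) ⇒ (ι c)‾ ∈ ca(T_h)` (levels: `c̄ ∈ caᴺ(C_h)`, `x̄, ȳ ∈ caⁿ⁺³(T_h)` give
`(ι c)‾ ∈ caᵐ⁺³(T_h)` for `m = max(n, N)`). [OURS · L1 w44b] -/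
theorem mk_inclusion_mem_cohomologyAnnihilator' (h : MvPolynomial (Fin (n + 1)) k) (hh : h ≠ 0)
    (c : MvPolynomial (Fin (n + 1)) k)
    (hc : Ideal.Quotient.mk (Ideal.span ({h} : Set (MvPolynomial (Fin (n + 1)) k))) c ∈
      cohomologyAnnihilator (MvPolynomial (Fin (n + 1)) k ⧸ Ideal.span ({h} : Set (MvPolynomial (Fin (n + 1)) k)))) :
    Ideal.Quotient.mk (Ideal.span ({X 0 * X 1 - (MvPolynomial.aeval (fun j : Fin (n + 1) =>
        (X j.succ.succ : MvPolynomial (Fin (n + 3)) k))) h} : Set (MvPolynomial (Fin (n + 3)) k)))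
        ((MvPolynomial.aeval (fun j : Fin (n + 1) => (X j.succ.succ : MvPolynomial (Fin (n + 3)) k))) c) ∈
      cohomologyAnnihilator (MvPolynomial (Fin (n + 3)) k ⧸ Ideal.span ({X 0 * X 1 -
        (MvPolynomial.aeval (fun j : Fin (n + 1) => (X j.succ.succ : MvPolynomial (Fin (n + 3)) k))) h} :
          Set (MvPolynomial (Fin (n + 3)) k))) := by
  obtain ⟨N, hN⟩ := mem_cohomologyAnnihilator_iff.mp hc
  obtain ⟨Ψ, hΨsurj, hkerΨ, hΨ⟩ := ArenaGeneral.exists_ringHom_middleStage k n h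
  obtain ⟨π, hπsurj, hkerπ, hπ⟩ := ArenaGeneralMiddle.exists_ringHom_curveStage k n h
  have hΨb : Ψ (Ideal.Quotient.mk _ (X 0)) = Ideal.Quotient.mk _ (X 0) := by
    rw [hΨ, MvPolynomial.aeval_X, Fin.cons_zero]
  have hkerπ' : RingHom.ker π = Ideal.span {Ψ (Ideal.Quotient.mk _ (X 0))} := by rw [hΨb]; exact hkerπ
  have hb : Ψ (Ideal.Quotient.mk _ (X 0)) ∈ (MvPolynomial (Fin (n + 2)) k ⧸ Ideal.span ({X 0 ^ 2 -
      (MvPolynomial.aeval (fun j : Fin (n + 1) => (X j.succ : MvPolynomial (Fin (n + 2)) k))) h} :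
        Set (MvPolynomial (Fin (n + 2)) k)))⁰ := by
    rw [hΨb]
    exact ArenaGeneralMiddle.mk_X0_mem_nonZeroDivisors k n h hh
  have ha := Ideal.sub_mem _ (ArenaGeneral.mk_X0_mem_cohomologyAnnihilatorOfDegree k n h)
    (ArenaGeneral.mk_X1_mem_cohomologyAnnihilatorOfDegree k n h)
  rw [← map_sub] at ha
  refine mem_cohomologyAnnihilator_iff.mpr ⟨(n + N) + 3, ?_⟩
  refine mem_cohomologyAnnihilatorOfDegree_of_surjective_surjective Ψ hΨsurj hkerΨ
    (mk_X0_sub_X1_mem_nonZeroDivisors' k n h) π hπsurj hkerπ' hb (m := n + N)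
    (cohomologyAnnihilatorOfDegree_mono (by omega) ha)
    (cohomologyAnnihilatorOfDegree_mono (by omega) (ArenaGeneral.mk_X0_mem_cohomologyAnnihilatorOfDegree k n h)) ?_
  rw [hΨ, ArenaGeneral.sigma_inclusion, hπ, ArenaGeneralMiddle.retraction_comp_inclusion]
  exact cohomologyAnnihilatorOfDegree_mono (by omega) hN

/-! ## §3 The `A_{m−1}` surface `xy = zᵐ` over every field -/

section Surface

variable (m : ℕ)

/-- **The `A_r`-ARRIVAL FLOOR over EVERY field**: `z̄^⌊m/2⌋ ∈ ca³(k[x,y,z]/(xy − zᵐ))` (with `m = r + 1`: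
`z^⌈r/2⌉ ∈ ca³(A_r)`), characteristic `2` included.  This seat's truncated principal floor
`z̄^⌊m/2⌋ ∈ ca¹(k[z]/(zᵐ))` (`PersistenceArArrivalFloor.mvPolynomial_X_pow_half_mem_cohomologyAnnihilatorOfDegree_one`,
p558318) lifted by §2 at `n = 0`. [cite: IyengarTakahashi2014, Remark 2.13] -/
theorem X_two_pow_half_mem_cohomologyAnnihilatorOfDegree_three' :
    Ideal.Quotient.mk (Ideal.span {(MvPolynomial.X 0 * MvPolynomial.X 1 - MvPolynomial.X 2 ^ m :
        MvPolynomial (Fin 3) k)}) (MvPolynomial.X 2 ^ (m / 2)) ∈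
      cohomologyAnnihilatorOfDegree (MvPolynomial (Fin 3) k ⧸
        Ideal.span {(MvPolynomial.X 0 * MvPolynomial.X 1 - MvPolynomial.X 2 ^ m : MvPolynomial (Fin 3) k)}) 3 := by
  have hh : ((MvPolynomial.X 0 : MvPolynomial (Fin 1) k) ^ m) ≠ 0 := pow_ne_zero _ (MvPolynomial.X_ne_zero _)
  have h1 : Ideal.Quotient.mk (Ideal.span {(MvPolynomial.X 0 : MvPolynomial (Fin 1) k) ^ m})
      ((MvPolynomial.X 0 : MvPolynomial (Fin 1) k) ^ (m / 2)) ∈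
      cohomologyAnnihilatorOfDegree
        (MvPolynomial (Fin 1) k ⧸ Ideal.span {(MvPolynomial.X 0 : MvPolynomial (Fin 1) k) ^ m}) (0 + 1) := by
    rw [map_pow]
    exact PersistenceArArrivalFloor.mvPolynomial_X_pow_half_mem_cohomologyAnnihilatorOfDegree_one k m
  have h3 := mk_inclusion_mem_cohomologyAnnihilatorOfDegree' k 0 _ hh ((MvPolynomial.X 0 : MvPolynomial (Fin 1) k) ^ (m / 2)) h1
  have hI : Ideal.span {MvPolynomial.X 0 * MvPolynomial.X 1 -
      (MvPolynomial.aeval fun j : Fin (0 + 1) => (MvPolynomial.X j.succ.succ : MvPolynomial (Fin (0 + 3)) k))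
        ((MvPolynomial.X 0 : MvPolynomial (Fin 1) k) ^ m)} =
      Ideal.span {(MvPolynomial.X 0 * MvPolynomial.X 1 - MvPolynomial.X 2 ^ m : MvPolynomial (Fin 3) k)} := by
    rw [PersistenceArArrivalFloor.aeval_inclusion_X_pow]
  have h4 := ringEquiv_apply_mem_cohomologyAnnihilatorOfDegree (Ideal.quotEquivOfEq hI) h3
  rwa [Ideal.quotEquivOfEq_mk, PersistenceArArrivalFloor.aeval_inclusion_X_pow k (m / 2)] at h4

/-- The same in the full cohomology annihilator: `z̄^⌊m/2⌋ ∈ ca(k[x,y,z]/(xy − zᵐ))`, every field.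
[cite: IyengarTakahashi2014, Definition 2.1] -/
theorem X_two_pow_half_mem_cohomologyAnnihilator' :
    Ideal.Quotient.mk (Ideal.span {(MvPolynomial.X 0 * MvPolynomial.X 1 - MvPolynomial.X 2 ^ m :
        MvPolynomial (Fin 3) k)}) (MvPolynomial.X 2 ^ (m / 2)) ∈
      cohomologyAnnihilator (MvPolynomial (Fin 3) k ⧸
        Ideal.span {(MvPolynomial.X 0 * MvPolynomial.X 1 - MvPolynomial.X 2 ^ m : MvPolynomial (Fin 3) k)}) :=
  cohomologyAnnihilatorOfDegree_le 3 (X_two_pow_half_mem_cohomologyAnnihilatorOfDegree_three' k m)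

/-- **`(x̄, ȳ, z̄^⌊m/2⌋) ⊆ ca³(k[x,y,z]/(xy − zᵐ))` over EVERY field** — the floor half of the `A_r` table
`ca(A_r) = (x, y, z^⌈r/2⌉)` (`…ArenaIdealFormula`, which carries `2 ≠ 0` for the other half).
[cite: IyengarTakahashi2014, Definition 2.1] -/
theorem span_le_cohomologyAnnihilatorOfDegree_three_arena' :
    (Ideal.span ({MvPolynomial.X 0, MvPolynomial.X 1, MvPolynomial.X 2 ^ (m / 2)} : Set (MvPolynomial (Fin 3) k))).map
        (Ideal.Quotient.mk (Ideal.span {(MvPolynomial.X 0 * MvPolynomial.X 1 - MvPolynomial.X 2 ^ m :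
          MvPolynomial (Fin 3) k)})) ≤
      cohomologyAnnihilatorOfDegree (MvPolynomial (Fin 3) k ⧸
        Ideal.span {(MvPolynomial.X 0 * MvPolynomial.X 1 - MvPolynomial.X 2 ^ m : MvPolynomial (Fin 3) k)}) 3 := by
  have hf : (MvPolynomial.X 0 * MvPolynomial.X 1 - MvPolynomial.X 2 ^ m : MvPolynomial (Fin 3) k) =
      MvPolynomial.X 0 * MvPolynomial.X 1 - (MvPolynomial.aeval fun j : Fin (0 + 1) =>
        (MvPolynomial.X j.succ.succ : MvPolynomial (Fin (0 + 3)) k)) ((MvPolynomial.X 0 : MvPolynomial (Fin 1) k) ^ m) := by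
    rw [PersistenceArArrivalFloor.aeval_inclusion_X_pow]
  rw [Ideal.map_span, Ideal.span_le]
  rintro _ ⟨g, hg, rfl⟩
  simp only [Set.mem_insert_iff, Set.mem_singleton_iff] at hg
  rcases hg with rfl | rfl | rfl
  · have h0 := ArenaGeneral.mk_X0_mem_cohomologyAnnihilatorOfDegree k 0 ((MvPolynomial.X 0 : MvPolynomial (Fin 1) k) ^ m)
    rw [← hf] at h0
    exact h0
  · have h0 := ArenaGeneral.mk_X1_mem_cohomologyAnnihilatorOfDegree k 0 ((MvPolynomial.X 0 : MvPolynomial (Fin 1) k) ^ m)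
    rw [← hf] at h0
    exact h0
  · exact X_two_pow_half_mem_cohomologyAnnihilatorOfDegree_three' k m

end Surface

end Summit.ResolutionOfSingularities.ResolutionOfSingularities.Theorems.HomologicalConductor.ArenaFloorCharFree

end
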